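import Literature.NumberTheory.NumberFields.RayClassFieldOfCharacters
import Literature.NumberTheory.GaloisRepresentations.HeckeCharacterOfRayClass
import HarnessLib

/-!
# Lemmas for the auxiliary Hecke characters of Jacquet–Langlands' Lemma 12.5 (pure proofs; tools
for `Automorphic/PiOfArtinRepChevalleyProofs`)

`PiOfArtinRepAuxiliaryCharactersProofs` reduces Gelbart's Prop. 4.1 (both unramified shadows) to
the twisted Hecke theory of `GL(2)` and to the idelic hypothesis `Hη`: for a finite place `v`, a
finite set `S ∌ v` and `N`, a finite-order Hecke character trivial at `v` whose `k`-th powers,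
`0 < k ≤ N`, are ramified at every place of `S` (Jacquet–Langlands 1970, Lemma 12.5, order form).
The sibling file `PiOfArtinRepChevalleyProofs` proves `Hη` from Chevalley's congruence subgroup
theorem for the `{v}`-units by an explicit ray class character; this file supplies the pieces of
that construction which do not mention ideles of a specific shape:

* `exists_monoidHom_apply_pow_eq_one_imp` — **characters of a finite abelian group separating a
  cyclic subgroup from another subgroup**: for `c ∈ G` and `D ≤ G` there is `χ : G → ℂˣ` trivial
  on `D` with `χ(c^i) = 1 ⟹ c^i ∈ D` (an injective character of the cyclic group generated by the
  image of `c` in `G/D` — a primitive root of unity of the right order, Mathlib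
  `monoidHomOfForallMemZpowers` — extended to `G/D` by Mathlib's duality
  `MonoidHom.restrict_surjective`).
* `exists_unit_pow_sub_one` — **the global unit `a = 1 + N(𝔭_w)` at `w`**: `|a|_w = 1`, and for
  every `N` there is `m > 0` with `a^k ≢ 1 mod 𝔭_w^m` for all `0 < k ≤ N` (`a^k - 1 ≠ 0` has a
  finite `w`-adic valuation).
* `le_modulusExp_finsetProd`, `mem_of_finsetProd_le` — the multiplicities and the prime divisors
  of a modulus `∏_{u ∈ s} 𝔭_u^{n_u}`.
* `valuation_eq_exp_neg_count` — `|b|_u = q_u^{-ν_u((b))}` for `b ∈ F^×`.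
* `rayIdeleValue_principalIdele_eq_apply_mk` — **the ideal character of a principal idele**: for a
  character `χ` of the ray class group `Cl_F^𝔪` and `b ∈ F^×` with `(b)` prime to `𝔪`, Tate's
  `ω₀((b)) = ∏_{𝔭 ∤ 𝔪} χ([𝔭])^{ord_𝔭 b}` (`rayIdeleValue` of the ray class character `𝔭 ↦ χ([𝔭])`,
  `NumberFields.isRayClassCharacter_primeClass`) equals `χ([(b)])`
  (`NumberFields.artinHom_primeClass_eq_mk`).

No definition and no named fact is introduced (D-0026).

## References

* H. Jacquet, R. P. Langlands, *Automorphic Forms on GL(2)*, LNM 114 (1970), Lemma 12.5.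
  [JacquetLanglands1970]
* C. Chevalley, *Deux théorèmes d'arithmétique*, J. Math. Soc. Japan 3 (1951), 36–44, Thm. 1.
* J. Neukirch, *Algebraic Number Theory* (1999), Ch. VI §1 (1.7)–(1.9); Ch. VII §6 (6.13)–(6.14).
  [NeukirchANT1999]
-/

noncomputable section

open scoped NumberField nonZeroDivisors
open NumberField IsDedekindDomain Field Filter Topology Set

namespace Literature.NumberTheory.Automorphic

/-! ### Characters of finite abelian groups -/

section GroupTheory

/-- **A character trivial on `D` and faithful on the cyclic group generated by `c` modulo `D`.**
For a finite abelian group `G`, `c ∈ G` and a subgroup `D` there is `χ : G →* ℂˣ` with `χ(D) = 1`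
and `χ(c^i) = 1 ⟹ c^i ∈ D` for all `i`: in `Q = G/D` the cyclic group `H = ⟨c̄⟩` of order `n` has
the injective character `c̄ ↦ e^{2πi/n}` (Mathlib `monoidHomOfForallMemZpowers`,
`Complex.isPrimitiveRoot_exp`), which extends to `Q` (Mathlib `MonoidHom.restrict_surjective`,
duality for finite abelian groups); compose with `G → Q`. [folklore] -/
theorem exists_monoidHom_apply_pow_eq_one_imp {G : Type*} [CommGroup G] [Finite G] (c : G)
    (D : Subgroup G) :
    ∃ χ : G →* ℂˣ, (∀ d ∈ D, χ d = 1) ∧ ∀ i : ℕ, χ (c ^ i) = 1 → c ^ i ∈ D := by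
  classical
  set Q := G ⧸ D with hQ
  haveI : Finite Q := Quotient.finite _
  set cbar : Q := QuotientGroup.mk c with hcbar
  set H : Subgroup Q := Subgroup.zpowers cbar with hH
  haveI : Finite H := Subtype.finite
  -- an injective character of the cyclic group `H`
  set n : ℕ := orderOf cbar with hn
  have hn0 : n ≠ 0 := (orderOf_pos cbar).ne'
  set ζ : ℂˣ := Units.mk0 (Complex.exp (2 * Real.pi * Complex.I / n)) (Complex.exp_ne_zero _)
    with hζ
  have hζprim : IsPrimitiveRoot ζ n := by
    rw [← IsPrimitiveRoot.coe_units_iff, hζ, Units.val_mk0]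
    exact Complex.isPrimitiveRoot_exp n hn0
  set g : H := ⟨cbar, Subgroup.mem_zpowers cbar⟩ with hg
  have hgen : ∀ x : H, x ∈ Subgroup.zpowers g := by
    rintro ⟨x, hx⟩
    obtain ⟨k, rfl⟩ := Subgroup.mem_zpowers_iff.mp hx
    exact ⟨k, Subtype.ext (by rw [hg]; simp)⟩
  have hord : orderOf ζ ∣ orderOf g := by
    rw [← hζprim.eq_orderOf, hg, Subgroup.orderOf_mk]
  set ψH : H →* ℂˣ := monoidHomOfForallMemZpowers hgen hord with hψH
  have hψHg : ψH g = ζ := monoidHomOfForallMemZpowers_apply_gen hgen hord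
  -- extend to `Q`
  haveI := GaloisRepresentations.hasEnoughRootsOfUnity_exponent_of_finite Q
  obtain ⟨φ, hφ⟩ := MonoidHom.restrict_surjective (M := ℂ) H ψH
  refine ⟨φ.comp (QuotientGroup.mk' D), fun d hd => ?_, fun i hi => ?_⟩
  · rw [MonoidHom.comp_apply, QuotientGroup.mk'_apply, (QuotientGroup.eq_one_iff d).mpr hd, map_one]
  · rw [MonoidHom.comp_apply, QuotientGroup.mk'_apply, QuotientGroup.mk_pow] at hi
    have h1 : φ (cbar ^ i) = ψH (g ^ i) := by
      rw [← hφ]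
      rfl
    rw [h1, map_pow, hψHg] at hi
    have hdvd : n ∣ i := by
      rw [hζprim.eq_orderOf]
      exact orderOf_dvd_of_pow_eq_one hi
    have hci : cbar ^ i = 1 := by
      rw [hn] at hdvd
      exact orderOf_dvd_iff_pow_eq_one.mp hdvd
    rw [hcbar, ← QuotientGroup.mk_pow, QuotientGroup.eq_one_iff] at hci
    exact hci

end GroupTheory

/-! ### The global unit `1 + N(𝔭_w)` -/

section Arithmetic

variable {F : Type} [Field F] [NumberField F]

/-- **The auxiliary unit at `w`.**  For a finite place `w` of the number field `F` and `N ∈ ℕ`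
there are `a ∈ F` with `|a|_w = 1`, `a ≠ 0`, and `m ∈ ℕ` such that `|a^k - 1|_w > q_w^{-m}` for
all `0 < k ≤ N`: take `a = 1 + q_w` (`q_w = N(𝔭_w) ∈ 𝔭_w`, so `|a|_w = 1`; `a^k - 1` is a
non-zero rational integer, so its `w`-adic valuation is finite) and `m` larger than the finitely
many exponents `ord_w(a^k - 1)`, `k ≤ N`. [folklore] -/
theorem exists_unit_pow_sub_one (w : HeightOneSpectrum (𝓞 F)) (N : ℕ) :
    ∃ (a : F) (m : ℕ), w.valuation F a = 1 ∧ a ≠ 0 ∧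
      ∀ k : ℕ, 0 < k → k ≤ N →
        ¬ w.valuation F (a ^ k - 1) ≤ WithZero.exp (-(m : ℤ)) := by
  classical
  set q : ℕ := Ideal.absNorm w.asIdeal with hq
  have hq2 : 2 ≤ q := LFunctions.AbelianDensity.two_le_absNorm (K := F) w
  set a : F := 1 + (q : F) with ha
  have hqval : w.valuation F (q : F) < 1 := by
    have hmem : ((q : ℕ) : 𝓞 F) ∈ w.asIdeal := by
      rw [hq]; exact Ideal.absNorm_mem _
    have h := (w.intValuation_lt_one_iff_mem _).mpr hmem
    rw [← HeightOneSpectrum.valuation_of_algebraMap (K := F)] at h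
    simpa using h
  have haval : w.valuation F a = 1 := by
    rw [ha]
    exact Valuation.map_one_add_of_lt _ hqval
  have hane : ∀ k : ℕ, 0 < k → a ^ k - 1 ≠ 0 := by
    intro k hk h
    have h' : ((1 + q) ^ k : ℕ) = ((1 : ℕ) : F) := by
      push_cast
      rw [← ha]
      exact sub_eq_zero.mp h
    have h'' := Nat.cast_injective h'
    have : 1 < (1 + q) ^ k := Nat.one_lt_pow hk.ne' (by omega)
    omega
  -- `m` exceeds all the (finitely many) exponents `-log |a^k - 1|_w`, `k ≤ N`
  set f : ℕ → ℕ := fun k => (-WithZero.log (w.valuation F (a ^ k - 1))).toNat with hf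
  refine ⟨a, (Finset.range (N + 1)).sup f + 1, haval, ?_, fun k hk hkN hle => ?_⟩
  · intro h0
    rw [h0, map_zero] at haval
    exact zero_ne_one haval
  · have hne : w.valuation F (a ^ k - 1) ≠ 0 := by
      rw [Ne, map_eq_zero]; exact hane k hk
    have hle1 : w.valuation F (a ^ k - 1) ≤ 1 := by
      have hint : w.valuation F (a ^ k) ≤ 1 := by rw [map_pow, haval, one_pow]
      calc w.valuation F (a ^ k - 1)
          ≤ max (w.valuation F (a ^ k)) (w.valuation F 1) := Valuation.map_sub _ _ _
        _ ≤ 1 := max_le hint (by rw [map_one])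
    have hlog : WithZero.log (w.valuation F (a ^ k - 1)) ≤ 0 := by
      rw [← WithZero.exp_log hne, ← WithZero.exp_zero, WithZero.exp_le_exp] at hle1
      exact hle1
    have h1 : (f k : ℤ) = -WithZero.log (w.valuation F (a ^ k - 1)) := by
      simp only [hf]
      exact Int.toNat_of_nonneg (by omega)
    have h2 : WithZero.log (w.valuation F (a ^ k - 1)) ≤
        -(((Finset.range (N + 1)).sup f + 1 : ℕ) : ℤ) := by
      rw [← WithZero.exp_log hne, WithZero.exp_le_exp] at hle
      exact hle
    have hkmem : k ∈ Finset.range (N + 1) := Finset.mem_range.mpr (by omega)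
    have h3 : (f k : ℤ) ≤ (((Finset.range (N + 1)).sup f : ℕ) : ℤ) := by
      exact_mod_cast Finset.le_sup (f := f) hkmem
    push_cast at h2
    omega

end Arithmetic

/-! ### Moduli `∏ 𝔭_u^{n_u}` and values of the ideal character -/

section Modulus

variable {F : Type} [Field F] [NumberField F]

open GaloisRepresentations in
/-- `n_u ≤ ν_u(∏_{x ∈ s} 𝔭_x^{n_x})` for `u ∈ s` (in fact equality; the inequality is what is
used: the congruence subgroup of the modulus imposes at least `n_u`). [folklore] -/
theorem le_modulusExp_finsetProd (s : Finset (HeightOneSpectrum (𝓞 F)))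
    (n : HeightOneSpectrum (𝓞 F) → ℕ) {u : HeightOneSpectrum (𝓞 F)} (hu : u ∈ s) :
    n u ≤ modulusExp (∏ x ∈ s, x.asIdeal ^ n x) u := by
  have hne := finsetProd_pow_ne_bot s n
  rw [modulusExp, ← Associates.prime_pow_dvd_iff_le (Associates.mk_ne_zero.mpr hne)
    ((Associates.irreducible_mk).mpr u.irreducible), ← Associates.mk_pow,
    Associates.mk_le_mk_iff_dvd]
  exact Finset.dvd_prod_of_mem _ hu

/-- A prime dividing `∏_{x ∈ s} 𝔭_x^{n_x}` is one of the `𝔭_x`, `x ∈ s`, with `n_x ≠ 0`.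
[folklore] -/
theorem mem_of_finsetProd_le (s : Finset (HeightOneSpectrum (𝓞 F)))
    (n : HeightOneSpectrum (𝓞 F) → ℕ) {u : HeightOneSpectrum (𝓞 F)}
    (h : (∏ x ∈ s, x.asIdeal ^ n x) ≤ u.asIdeal) : u ∈ s ∧ n u ≠ 0 := by
  have huprime : Prime u.asIdeal := Ideal.prime_of_isPrime u.ne_bot u.isPrime
  obtain ⟨x, hx, hdvd⟩ := (Prime.dvd_finsetProd_iff huprime _).mp (Ideal.dvd_iff_le.mpr h)
  have hnx : n x ≠ 0 := by
    intro h0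
    rw [h0, pow_zero, Ideal.one_eq_top, Ideal.dvd_iff_le, top_le_iff] at hdvd
    exact u.isPrime.ne_top hdvd
  have hux : u = x := by
    have h1 : u.asIdeal ∣ x.asIdeal := huprime.dvd_of_dvd_pow hdvd
    exact HeightOneSpectrum.ext
      ((x.isMaximal.eq_of_le u.isPrime.ne_top (Ideal.dvd_iff_le.mp h1)).symm)
  subst hux
  exact ⟨hx, hnx⟩

open GaloisRepresentations in
/-- `|b|_u = exp(-ν_u((b)))` for `b ∈ Fˣ` (`count_toPrincipalIdeal`). [folklore] -/
theorem valuation_eq_exp_neg_count (u : HeightOneSpectrum (𝓞 F)) (b : Fˣ) :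
    u.valuation F (b : F) = WithZero.exp (-(FractionalIdeal.count F u
      (toPrincipalIdeal (𝓞 F) F b : FractionalIdeal (𝓞 F)⁰ F))) := by
  rw [count_toPrincipalIdeal, neg_neg, WithZero.exp_log]
  exact (Valuation.ne_zero_iff _).mpr b.ne_zero

open GaloisRepresentations NumberFields in
/-- **The ideal character of a principal idele prime to `𝔪`.**  For a character `χ` of the ray
class group `Cl_F^𝔪` (`𝔪 ≠ 0`) and `b ∈ Fˣ` with `(b)` prime to `𝔪`, Tate's
`ω₀((b)) = ∏_{𝔭 ∤ 𝔪} χ([𝔭])^{ord_𝔭 b}` — the `rayIdeleValue` of the ray class character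
`𝔭 ↦ χ([𝔭])` (`isRayClassCharacter_primeClass`) on the principal idele of `b` — is `χ([(b)])`:
`ord_𝔭 (b) = ν_𝔭((b))` (`ideleOrd_principalIdele`, `count_toPrincipalIdeal`) and
`∏_𝔭 [𝔭]^{ν_𝔭(I)} = [I]` (`artinHom_primeClass_eq_mk`).  Neukirch VII (6.13)–(6.14) (the
Größencharakter of a character of `Cl^𝔪` on principal ideals prime to `𝔪`).
[cite: NeukirchANT1999, Ch. VII §6 Cor. (6.14)] -/
theorem rayIdeleValue_principalIdele_eq_apply_mk {𝔪 : Ideal (𝓞 F)} (h𝔪 : 𝔪 ≠ ⊥)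
    [Finite (RayClassGroup 𝔪)] (χ : RayClassGroup 𝔪 →* ℂˣ) (b : Fˣ)
    (hb : toPrincipalIdeal (𝓞 F) F b ∈ idealsPrimeTo 𝔪) :
    rayIdeleValue (isRayClassCharacter_primeClass h𝔪 χ) (GaloisRepresentations.principalIdele F b) =
      χ (QuotientGroup.mk ⟨toPrincipalIdeal (𝓞 F) F b, hb⟩) := by
  have hfin : Function.HasFiniteMulSupport fun u : HeightOneSpectrum (𝓞 F) =>
      primeClass 𝔪 h𝔪 u ^ FractionalIdeal.count F u
        (toPrincipalIdeal (𝓞 F) F b : FractionalIdeal (𝓞 F)⁰ F) := by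
    have h := FractionalIdeal.finite_factors (K := F)
      (toPrincipalIdeal (𝓞 F) F b : FractionalIdeal (𝓞 F)⁰ F)
    rw [Filter.eventually_cofinite] at h
    refine Set.Finite.subset h fun u hu => ?_
    rw [Function.mem_mulSupport] at hu
    intro h0
    exact hu (by rw [h0, zpow_zero])
  rw [← artinHom_primeClass_eq_mk h𝔪 _ hb, artinHom_apply]
  have hmap := MonoidHom.map_finprod (f := fun u : HeightOneSpectrum (𝓞 F) =>
      primeClass 𝔪 h𝔪 u ^ FractionalIdeal.count F u
        (toPrincipalIdeal (𝓞 F) F b : FractionalIdeal (𝓞 F)⁰ F)) χ hfin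
  erw [hmap]
  unfold rayIdeleValue
  refine finprod_congr fun u => ?_
  rw [map_zpow, ideleOrd_principalIdele, ← count_toPrincipalIdeal]
  congr 1
  by_cases hu : 𝔪 ≤ u.asIdeal
  · rw [rayUnitValue_of_le _ hu, primeClass_eq, unitOfPrime_of_le h𝔪 hu, QuotientGroup.mk_one,
      map_one]
  · exact Units.ext (by rw [coe_rayUnitValue_of_not_le _ hu])

end Modulus

end Literature.NumberTheory.Automorphic

end
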